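import Mathlib
import Summits.ValiantsHypothesis.ValiantsHypothesis.Theorems.DivisionGapShadowBirkhoffCounterDefs

/-!
# The ternary two-polarity cut counter (stub `stub_counter` of `DivisionGap.ShadowBirkhoff`)

Support file for item `stmt-ValiantsHypothesis-5069` (route `DivisionGap`, crux `ShadowBirkhoff`,
line `Sketch-ideator4`): the registered stub `stub_counter` of the line's skeleton, on the objects
`sdot`, `qdis`, `X2`, `Y4` of `Theorems/DivisionGapShadowBirkhoffCounterDefs.lean`.

In the abstract point model of the counter (digits `3^i`, `i < K`; a cut is a pair `(α, β)` of Boolean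
digit vectors with abscissa `X2 α β = sdot α + sdot β` and ordinate
`Y4 α β = 4·sdot α·sdot β + 2·qdis α β`) every DIAGONAL point `(D, D)` is the strict unique minimiser
of `Y4 − μ·X2` for the integer slope `μ = 4·sdot D + 1`, and `|μ| ≤ 3^(K+1)`.

Proof.  With `a = sdot α`, `b = sdot β`, `s = sdot D`, `q = qdis α β`, `n = a + b − 2s` one has the
identity `(Y4 α β − μ X2 α β) − (Y4 D D − μ X2 D D) = n (n − 1) + (2q − (a − b)²)`.  Here
`n (n − 1) ≥ 0` for every integer `n`; and splitting the digits into `A = ∑_{α i ∧ ¬β i} 3^i`,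
`B = ∑_{β i ∧ ¬α i} 3^i` gives `a − b = A − B`, `q = ∑_{α i ∧ ¬β i} 9^i + ∑_{β i ∧ ¬α i} 9^i`, and the
3-adic slack `(∑_{T} 3^i)² + ∑_{T} 3^i ≤ 2 ∑_{T} 9^i` yields `2q − (a − b)² ≥ A + B ≥ 0`, with
`A + B ≥ 1` when `α ≠ β`.  When `α = β ≠ D`, injectivity of `sdot` (ternary digits `0/1`) gives
`a ≠ s`, so `n = 2(a − s)` is a nonzero even integer and `n (n − 1) ≥ 2`.

Only Mathlib and the CounterDefs objects are used.
-/

set_option linter.dupNamespace false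

noncomputable section

open scoped BigOperators

namespace Summit.ValiantsHypothesis.ValiantsHypothesis.Theorems.DivisionGapShadowBirkhoff

/-! ## Digit sums: peeling the last digit, range bound, 3-adic slack, injectivity -/

/-- Peeling the last digit of `sdot`. [folklore] -/
theorem counter_sdot_succ {K : ℕ} (T : Fin (K + 1) → Bool) :
    sdot T = sdot (fun i => T (Fin.castSucc i)) + (if T (Fin.last K) then (3 : ℤ) ^ K else 0) := by
  simp [sdot, Fin.sum_univ_castSucc]

/-- Peeling the last digit of the squared-digit sum `∑_{i : T i} 9^i`. [folklore] -/
theorem counter_nsum_succ {K : ℕ} (T : Fin (K + 1) → Bool) :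
    (∑ i : Fin (K + 1), if T i then (9 : ℤ) ^ (i : ℕ) else 0) =
      (∑ i : Fin K, if T (Fin.castSucc i) then (9 : ℤ) ^ (i : ℕ) else 0)
        + (if T (Fin.last K) then (9 : ℤ) ^ K else 0) := by
  simp [Fin.sum_univ_castSucc]

/-- `sdot` is nonnegative. [folklore] -/
theorem counter_sdot_nonneg {K : ℕ} (T : Fin K → Bool) : 0 ≤ sdot T := by
  unfold sdot
  exact Finset.sum_nonneg (fun i _ => by positivity)

/-- A Boolean digit `if b then P else 0` is `0` or `P`. [folklore] -/
theorem counter_ite_or (b : Bool) (P : ℤ) :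
    (if b then P else 0) = 0 ∨ (if b then P else 0) = P := by
  cases b <;> simp

/-- The squared digit: `(if b then 9^K else 0) = (if b then 3^K else 0)²`. [folklore] -/
theorem counter_ite_nine (b : Bool) (K : ℕ) :
    (if b then (9 : ℤ) ^ K else 0) = (if b then (3 : ℤ) ^ K else 0) * (if b then (3 : ℤ) ^ K else 0) := by
  have h9 : (9 : ℤ) ^ K = 3 ^ K * 3 ^ K := by rw [← mul_pow]; norm_num
  cases b <;> simp [h9]

/-- Range bound and 3-adic slack: `2·sdot T + 1 ≤ 3^K` and `(sdot T)² + sdot T ≤ 2·∑_{T} 9^i`.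
[folklore] -/
theorem counter_slack : ∀ (K : ℕ) (T : Fin K → Bool),
    2 * sdot T + 1 ≤ (3 : ℤ) ^ K ∧
      sdot T ^ 2 + sdot T ≤ 2 * ∑ i : Fin K, if T i then (9 : ℤ) ^ (i : ℕ) else 0 := by
  intro K
  induction K with
  | zero =>
    intro T
    simp [sdot]
  | succ K ih =>
    intro T
    obtain ⟨h1, h2⟩ := ih (fun i => T (Fin.castSucc i))
    have h0 := counter_sdot_nonneg (fun i => T (Fin.castSucc i))
    have hP : (0 : ℤ) ≤ 3 ^ K := pow_nonneg (by norm_num) K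
    have hPP : 0 ≤ (3 : ℤ) ^ K * (3 ^ K - (2 * sdot (fun i => T (Fin.castSucc i)) + 1)) :=
      mul_nonneg hP (sub_nonneg.mpr h1)
    rw [counter_sdot_succ, counter_nsum_succ, counter_ite_nine, pow_succ (3 : ℤ) K]
    rcases counter_ite_or (T (Fin.last K)) ((3 : ℤ) ^ K) with ht | ht <;> rw [ht] <;>
      constructor <;> nlinarith [hPP, h1, h2, h0, hP]

/-- The last ternary digit is determined: from `X + [a]·P = X' + [d]·P` with `0 ≤ X, X'` and
`2X + 1, 2X' + 1 ≤ P` get `a = d` and `X = X'`. [folklore] -/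
theorem counter_last_digit (a d : Bool) (P X X' : ℤ) (hX : 0 ≤ X) (hX1 : 2 * X + 1 ≤ P)
    (hX' : 0 ≤ X') (hX1' : 2 * X' + 1 ≤ P)
    (h : X + (if a then P else 0) = X' + (if d then P else 0)) : a = d ∧ X = X' := by
  cases a <;> cases d <;> simp at h ⊢ <;> linarith

/-- Injectivity of `sdot` (ternary expansions with digits `0/1`). [folklore] -/
theorem counter_sdot_injective :
    ∀ (K : ℕ) (α D : Fin K → Bool), sdot α = sdot D → α = D := by
  intro K
  induction K with
  | zero =>
    intro α D _
    funext i
    exact i.elim0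
  | succ K ih =>
    intro α D h
    rw [counter_sdot_succ α, counter_sdot_succ D] at h
    obtain ⟨hlast, hrest⟩ := counter_last_digit _ _ _ _ _ (counter_sdot_nonneg _)
      (counter_slack K _).1 (counter_sdot_nonneg _) (counter_slack K _).1 h
    have ih' := ih _ _ hrest
    funext i
    refine Fin.lastCases ?_ (fun j => ?_) i
    · exact hlast
    · exact congrFun ih' j

/-- A digit that is on is at most the digit sum: `T i → 3^i ≤ sdot T`. [folklore] -/
theorem counter_digit_le {K : ℕ} (T : Fin K → Bool) (i : Fin K) (hi : T i = true) :
    (3 : ℤ) ^ (i : ℕ) ≤ sdot T := by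
  unfold sdot
  have h := Finset.single_le_sum (s := Finset.univ)
    (f := fun j : Fin K => if T j then (3 : ℤ) ^ (j : ℕ) else 0)
    (fun j _ => by positivity) (Finset.mem_univ i)
  simpa [hi] using h

/-! ## Splitting the digits of a pair `(α, β)` -/

/-- `sdot α = ∑_{α ∧ ¬β} 3^i + ∑_{α ∧ β} 3^i`. [folklore] -/
theorem counter_sdot_split {K : ℕ} (α β : Fin K → Bool) :
    sdot α = sdot (fun i => α i && !β i) + sdot (fun i => α i && β i) := by
  simp only [sdot]
  rw [← Finset.sum_add_distrib]
  refine Finset.sum_congr rfl (fun i _ => ?_)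
  rcases Bool.eq_false_or_eq_true (α i) with ha | ha <;>
    rcases Bool.eq_false_or_eq_true (β i) with hb | hb <;> simp [ha, hb]

/-- `qdis α β = ∑_{α ∧ ¬β} 9^i + ∑_{β ∧ ¬α} 9^i`. [folklore] -/
theorem counter_qdis_split {K : ℕ} (α β : Fin K → Bool) :
    qdis α β = (∑ i : Fin K, if (α i && !β i) then (9 : ℤ) ^ (i : ℕ) else 0)
      + ∑ i : Fin K, if (β i && !α i) then (9 : ℤ) ^ (i : ℕ) else 0 := by
  simp only [qdis]
  rw [← Finset.sum_add_distrib]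
  refine Finset.sum_congr rfl (fun i _ => ?_)
  rcases Bool.eq_false_or_eq_true (α i) with ha | ha <;>
    rcases Bool.eq_false_or_eq_true (β i) with hb | hb <;> simp [ha, hb]

/-- The gap term dominates the off-diagonal digit sums:
`∑_{α ∧ ¬β} 3^i + ∑_{β ∧ ¬α} 3^i ≤ 2·qdis α β − (sdot α − sdot β)²`. [folklore] -/
theorem counter_gap_nonneg {K : ℕ} (α β : Fin K → Bool) :
    sdot (fun i => α i && !β i) + sdot (fun i => β i && !α i)
      ≤ 2 * qdis α β - (sdot α - sdot β) ^ 2 := by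
  have hA := (counter_slack K (fun i => α i && !β i)).2
  have hB := (counter_slack K (fun i => β i && !α i)).2
  have hA0 := counter_sdot_nonneg (fun i => α i && !β i)
  have hB0 := counter_sdot_nonneg (fun i => β i && !α i)
  have hC : sdot (fun i => β i && α i) = sdot (fun i => α i && β i) := by
    congr 1
    funext i
    exact Bool.and_comm _ _
  rw [counter_qdis_split α β, counter_sdot_split α β, counter_sdot_split β α, hC]
  nlinarith [mul_nonneg hA0 hB0, hA, hB]

/-- Off the diagonal some digit differs: `α ≠ β → 1 ≤ ∑_{α ∧ ¬β} 3^i + ∑_{β ∧ ¬α} 3^i`. [folklore] -/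
theorem counter_offdiag_pos {K : ℕ} (α β : Fin K → Bool) (h : α ≠ β) :
    1 ≤ sdot (fun i => α i && !β i) + sdot (fun i => β i && !α i) := by
  obtain ⟨i, hi⟩ := Function.ne_iff.mp h
  have hA0 := counter_sdot_nonneg (fun i => α i && !β i)
  have hB0 := counter_sdot_nonneg (fun i => β i && !α i)
  have h1 : (1 : ℤ) ≤ 3 ^ (i : ℕ) := one_le_pow₀ (by norm_num)
  rcases Bool.eq_false_or_eq_true (α i) with ha | ha <;>
    rcases Bool.eq_false_or_eq_true (β i) with hb | hb
  · exact absurd (ha.trans hb.symm) hi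
  · have := counter_digit_le (fun i => α i && !β i) i (by simp [ha, hb])
    linarith
  · have := counter_digit_le (fun i => β i && !α i) i (by simp [ha, hb])
    linarith
  · exact absurd (ha.trans hb.symm) hi

/-- `n (n − 1) ≥ 0` for every integer `n`. [folklore] -/
theorem counter_mul_pred_nonneg (n : ℤ) : 0 ≤ n * (n - 1) := by
  rcases le_or_gt n 0 with h | h
  · have := mul_nonneg (neg_nonneg.mpr h) (by linarith : (0 : ℤ) ≤ 1 - n)
    nlinarith [this]
  · exact mul_nonneg h.le (by linarith)

/-! ## The counter theorem -/

/-- **The ternary two-polarity cut counter** (registered stub `stub_counter` of the skeleton of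
`DivisionGap.ShadowBirkhoff`, line `Sketch-ideator4`): for every `K` and digit vector `D` the integer
slope `μ = 4·sdot D + 1`, `|μ| ≤ 3^(K+1)`, makes the diagonal point `(D, D)` the strict unique minimiser
of `Y4 − μ·X2` among all `4^K` pairs `(α, β)`. -/
theorem stub_counter :
    ∀ (K : ℕ) (D : Fin K → Bool), ∃ μ : ℤ, |μ| ≤ 3 ^ (K + 1) ∧
      ∀ α β : Fin K → Bool, (α, β) ≠ (D, D) → Y4 D D - μ * X2 D D < Y4 α β - μ * X2 α β := by
  intro K D
  have hs0 : 0 ≤ sdot D := counter_sdot_nonneg D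
  have hs1 : 2 * sdot D + 1 ≤ (3 : ℤ) ^ K := (counter_slack K D).1
  have hP : (0 : ℤ) ≤ 3 ^ K := pow_nonneg (by norm_num) K
  refine ⟨4 * sdot D + 1, ?_, ?_⟩
  · rw [abs_of_nonneg (show (0 : ℤ) ≤ 4 * sdot D + 1 by linarith), pow_succ (3 : ℤ) K]
    linarith
  · intro α β hne
    have hqD : qdis D D = 0 := by simp [qdis]
    have key : Y4 α β - (4 * sdot D + 1) * X2 α β - (Y4 D D - (4 * sdot D + 1) * X2 D D)
        = (sdot α + sdot β - 2 * sdot D) * (sdot α + sdot β - 2 * sdot D - 1)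
          + (2 * qdis α β - (sdot α - sdot β) ^ 2) := by
      simp only [Y4, X2, hqD]
      ring
    have h3 := counter_mul_pred_nonneg (sdot α + sdot β - 2 * sdot D)
    have h4 := counter_gap_nonneg α β
    have hA0 := counter_sdot_nonneg (fun i => α i && !β i)
    have hB0 := counter_sdot_nonneg (fun i => β i && !α i)
    by_cases hab : α = β
    · have hαD : α ≠ D := fun h => hne (by rw [← hab, h])
      have has : sdot α ≠ sdot D := fun h => hαD (counter_sdot_injective K α D h)
      have hb : sdot β = sdot α := by rw [hab]
      have h5 : 2 ≤ (sdot α + sdot β - 2 * sdot D) * (sdot α + sdot β - 2 * sdot D - 1) := by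
        rw [hb]
        rcases lt_or_gt_of_ne has with h | h
        · nlinarith [mul_self_nonneg (sdot D - sdot α - 1)]
        · nlinarith [mul_self_nonneg (sdot α - sdot D - 1)]
      linarith
    · have h6 := counter_offdiag_pos α β hab
      linarith

end Summit.ValiantsHypothesis.ValiantsHypothesis.Theorems.DivisionGapShadowBirkhoff

end
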